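import Summits.CriticalPhenomena.CardyFormulaZ2.Theorems.CardyIKTransportIKLinearTransportStubPinnedSamplerCFTPPrep

/-!
# Stub `stub_PinnedSampler` — coupling from the past along rows, part 3b: THE PINNED SAMPLER
# from a coalescing row dynamics ((B) of the line report, PROVED)

Theorem-only support file (`--supports stmt-CriticalPhenomena-5076`, registered sub-goal
`ps2_pinnedSampler_of_rowCFTP`). THE CODING STEP of the remaining content of `stub_PinnedSampler`:
given, for the admissible pair `(S, i)`, a ROW-RESAMPLING DYNAMICS `Φ` of the middle data in the
environment `p = (eraseMid i x, stripDiagram i x)` — measurable, rewriting only the middle row it visits,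
vertically covariant, and EXACT (every sweep of the rows `a … a+n-1` from `X' ∼ νmix (S ∆ {i,i+1})` with fresh
bits has, jointly with the pinned statistic and on the events not reading the rows `≥ a+n`, the law of
`X'`: the row maps sample the conditional law of a middle row given the statistic and the rows below) — together with measurable, sound, vertically covariant CERTIFIED COALESCENCE events `Coal y m`
whose failure probability under `νmix S ⊗ β` is `≤ C e^{-c m}`, and local approximants of the depth-`r`
sweeps off an event of probability `≤ C e^{-c r}` (the dynamical form of strong spatial mixing in mean),
the COUPLING-FROM-THE-PAST map `G x u` (off the middle: `x`; middle row `y`: the bits of the first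
certified sweep ending at `y`, started blank) is a pinned sampler with constants
`(max C 0 · (2 + 4/c), c/2)`: measurable; `eraseMid` preserved surely; strip diagram preserved almost
surely and the exchanged law transported (Propp–Wilson, `ps2_cftp_jointLaw`, transferred from
`S ∆ {i,i+1}` to `S` along `StripDiagramExchange`); vertically covariant surely; quasi-local with
exponential tails (union bound over the `2r+1` rows of the ball plus the local-approximation event); the
null-set upgrade `ps_pinnedSampler_of_ae` (p94837) makes every clause sure. What remains of
`stub_PinnedSampler` after this file is the existence, uniformly in `(S, i)`, of such a pair `(Φ, Coal)`:
exponential coalescence IN MEAN of the grand coupling of the diagram-conditioned middle-column chain.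
-/

noncomputable section

namespace Summit.CriticalPhenomena.CardyFormulaZ2.Theorems.IKLinearTransport.PinnedDiagramExchange

open scoped Classical MeasureTheory ENNReal ProbabilityTheory symmDiff Topology
open Set MeasureTheory Filter
open Literature.Probability.Percolation Literature.Probability.LatticeModels

section Assembly

variable {S : Set ℤ} {i : ℤ} {Φ : ℤ → Obs × Set (Site 2 × Site 2) → Rnd → Obs → Obs}
  {T : ℕ → ℤ → Obs × Set (Site 2 × Site 2) → Rnd → Obs → Obs}
  {Coal : ℤ → ℕ → Set ((Obs × Set (Site 2 × Site 2)) × Rnd)}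
  {g : (Obs × Set (Site 2 × Site 2)) × Rnd → Obs}

/-- QUASI-LOCALITY of the CFTP map (clause 6 of `PinnedSampler`): off the `2r+1` events "no certified
depth `≤ r` at a row of the ball" and off the local-approximation event of the depth-`r` sweeps, the CFTP
map agrees on `ballInf v r` with a `2r`-local rule; union bound and `(2r+2) C e^{-cr} ≤ C' e^{-(c/2) r}`.
[folklore] -/
theorem ps2_cftp_locality {C c : ℝ} (hc : 0 < c)
    (hT : ∀ n a p u z, T n a p u z = ((fun q : ℤ × Obs => (q.1 + 1, Φ q.1 p u q.2))^[n] (a, z)).2)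
    (hCs : ∀ (y : ℤ) (m : ℕ) (p : Obs × Set (Site 2 × Site 2)) (u : Rnd), (p, u) ∈ Coal y m →
      ∀ z : Obs, (![i + 1, y] ∈ (T (m + 1) (y - m) p u z).1 ↔ ![i + 1, y] ∈ (T (m + 1) (y - m) p u p.1).1) ∧
        (![i, y] ∈ (T (m + 1) (y - m) p u z).2 ↔ ![i, y] ∈ (T (m + 1) (y - m) p u p.1).2) ∧
        (![i + 1, y] ∈ (T (m + 1) (y - m) p u z).2 ↔ ![i + 1, y] ∈ (T (m + 1) (y - m) p u p.1).2))
    (hCt : ∀ (y : ℤ) (m : ℕ), ((νmix S).prod β)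
      {xu | ((eraseMid i xu.1, stripDiagram i xu.1), xu.2) ∉ Coal y m} ≤
        ENNReal.ofReal (C * Real.exp (-c * m)))
    (hLoc : ∀ (v : Site 2) (r : ℕ), ∃ Gfin : Obs → Rnd → Obs,
      (∀ (x x' : Obs) (u u' : Rnd),
        (∀ w ∈ ballInf v (2 * r), (w ∈ x.1 ↔ w ∈ x'.1) ∧ (w ∈ x.2 ↔ w ∈ x'.2) ∧
          ∀ k : ℕ, ((w, k) ∈ u ↔ (w, k) ∈ u')) →
        ∀ w ∈ ballInf v r, (w ∈ (Gfin x u).1 ↔ w ∈ (Gfin x' u').1) ∧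
          (w ∈ (Gfin x u).2 ↔ w ∈ (Gfin x' u').2)) ∧
      ((νmix S).prod β) {xu | ∃ w ∈ ballInf v r,
        (w 0 = i + 1 ∧ ¬ (w ∈ (T (r + 1) (w 1 - r) (eraseMid i xu.1, stripDiagram i xu.1) xu.2
          (eraseMid i xu.1, stripDiagram i xu.1).1).1 ↔ w ∈ (Gfin xu.1 xu.2).1)) ∨
        ((w 0 = i ∨ w 0 = i + 1) ∧ ¬ (w ∈ (T (r + 1) (w 1 - r) (eraseMid i xu.1, stripDiagram i xu.1) xu.2
          (eraseMid i xu.1, stripDiagram i xu.1).1).2 ↔ w ∈ (Gfin xu.1 xu.2).2))} ≤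
        ENNReal.ofReal (C * Real.exp (-c * r)))
    (hg1 : ∀ p u (w : Site 2), w ∈ (g (p, u)).1 ↔ if w 0 = i + 1 then
      ∃ m : ℕ, ((p, u) ∈ Coal (w 1) m ∧ ∀ m' < m, (p, u) ∉ Coal (w 1) m') ∧
        w ∈ (T (m + 1) (w 1 - m) p u p.1).1 else w ∈ p.1.1)
    (hg2 : ∀ p u (f : Site 2), f ∈ (g (p, u)).2 ↔ if (f 0 = i ∨ f 0 = i + 1) then
      ∃ m : ℕ, ((p, u) ∈ Coal (f 1) m ∧ ∀ m' < m, (p, u) ∉ Coal (f 1) m') ∧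
        f ∈ (T (m + 1) (f 1 - m) p u p.1).2 else f ∈ p.1.2)
    (v : Site 2) (r : ℕ) :
    ∃ Gloc : Obs → Rnd → Obs,
      (∀ (x x' : Obs) (u u' : Rnd),
        (∀ w ∈ ballInf v (2 * r), (w ∈ x.1 ↔ w ∈ x'.1) ∧ (w ∈ x.2 ↔ w ∈ x'.2) ∧
          ∀ k : ℕ, ((w, k) ∈ u ↔ (w, k) ∈ u')) →
        ∀ w ∈ ballInf v r, (w ∈ (Gloc x u).1 ↔ w ∈ (Gloc x' u').1) ∧
          (w ∈ (Gloc x u).2 ↔ w ∈ (Gloc x' u').2)) ∧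
      ((νmix S).prod β) {xu | ∃ w ∈ ballInf v r,
          ¬ ((w ∈ (g ((eraseMid i xu.1, stripDiagram i xu.1), xu.2)).1 ↔ w ∈ (Gloc xu.1 xu.2).1) ∧
             (w ∈ (g ((eraseMid i xu.1, stripDiagram i xu.1), xu.2)).2 ↔ w ∈ (Gloc xu.1 xu.2).2))} ≤
        ENNReal.ofReal (max C 0 * (2 + 4 / c) * Real.exp (-(c / 2) * r)) := by
  obtain ⟨Gfin, hGl, hGb⟩ := hLoc v r
  set π : Obs → Obs × Set (Site 2 × Site 2) := fun x => (eraseMid i x, stripDiagram i x) with hπdef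
  set P := (νmix S).prod β with hP
  refine ⟨fun x u => ({w | if w 0 = i + 1 then w ∈ (Gfin x u).1 else w ∈ x.1},
    {f | if f 0 = i ∨ f 0 = i + 1 then f ∈ (Gfin x u).2 else f ∈ x.2}), fun x x' u u' hag w hw => ?_, ?_⟩
  · have hw2 : w ∈ ballInf v (2 * r) := by
      simp only [ballInf, mem_setOf_eq] at hw ⊢; push_cast; constructor <;> linarith [hw.1, hw.2]
    have hG := hGl x x' u u' hag w hw
    refine ⟨?_, ?_⟩
    · simp only [mem_setOf_eq]
      split_ifs
      · exact hG.1
      · exact (hag w hw2).1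
    · simp only [mem_setOf_eq]
      split_ifs
      · exact hG.2
      · exact (hag w hw2).2.1
  · -- the bad events
    set U : Set (Obs × Rnd) := ⋃ y ∈ Finset.Icc (v 1 - r) (v 1 + r), {xu | (π xu.1, xu.2) ∉ Coal y r}
      with hU
    set D : Set (Obs × Rnd) := {xu | ∃ w ∈ ballInf v r,
        (w 0 = i + 1 ∧ ¬ (w ∈ (T (r + 1) (w 1 - r) (π xu.1) xu.2 (π xu.1).1).1 ↔ w ∈ (Gfin xu.1 xu.2).1)) ∨
        ((w 0 = i ∨ w 0 = i + 1) ∧ ¬ (w ∈ (T (r + 1) (w 1 - r) (π xu.1) xu.2 (π xu.1).1).2 ↔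
          w ∈ (Gfin xu.1 xu.2).2))} with hD
    have hincl : {xu : Obs × Rnd | ∃ w ∈ ballInf v r,
        ¬ ((w ∈ (g (π xu.1, xu.2)).1 ↔ w ∈ ({w | if w 0 = i + 1 then w ∈ (Gfin xu.1 xu.2).1 else w ∈ xu.1.1},
            {f | if f 0 = i ∨ f 0 = i + 1 then f ∈ (Gfin xu.1 xu.2).2 else f ∈ xu.1.2}).1) ∧
          (w ∈ (g (π xu.1, xu.2)).2 ↔ w ∈ ({w | if w 0 = i + 1 then w ∈ (Gfin xu.1 xu.2).1 else w ∈ xu.1.1},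
            {f | if f 0 = i ∨ f 0 = i + 1 then f ∈ (Gfin xu.1 xu.2).2 else f ∈ xu.1.2}).2))} ⊆ U ∪ D := by
      rintro xu ⟨w, hw, hdis⟩
      by_cases hmemC : (π xu.1, xu.2) ∈ Coal (w 1) r
      · right
        refine ⟨w, hw, ?_⟩
        have hbits := ps2_cftp_bits_eq hT hCs ⟨r, le_rfl, hmemC⟩ (π xu.1).1
        simp only [mem_setOf_eq] at hdis
        by_cases hc1 : w 0 = i + 1
        · obtain ⟨y, rfl⟩ : ∃ y, w = ![i + 1, y] := ⟨w 1, by conv_lhs => rw [ps2_eq_vec2 w, hc1]⟩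
          have e0 : (![i + 1, y] : Site 2) 0 = i + 1 := rfl
          have e1 : (![i + 1, y] : Site 2) 1 = y := rfl
          rw [hg1, hg2, e0, e1, if_pos rfl, if_pos (Or.inr rfl), if_pos rfl, if_pos (Or.inr rfl)] at hdis
          rw [e1] at hbits
          rw [hbits.1, hbits.2.2] at hdis
          rw [e0, e1]
          by_cases hcell : (![i + 1, y] ∈ (T (r + 1) (y - r) (π xu.1) xu.2 (π xu.1).1).1 ↔
              ![i + 1, y] ∈ (Gfin xu.1 xu.2).1)
          · exact Or.inr ⟨Or.inr rfl, fun hface => hdis ⟨hcell, hface⟩⟩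
          · exact Or.inl ⟨rfl, hcell⟩
        · by_cases hc2 : w 0 = i
          · obtain ⟨y, rfl⟩ : ∃ y, w = ![i, y] := ⟨w 1, by conv_lhs => rw [ps2_eq_vec2 w, hc2]⟩
            have e0 : (![i, y] : Site 2) 0 = i := rfl
            have e1 : (![i, y] : Site 2) 1 = y := rfl
            have hne : ¬ (i = i + 1) := by omega
            rw [hg1, hg2, e0, e1, if_neg hne, if_pos (Or.inl rfl), if_neg hne, if_pos (Or.inl rfl)] at hdis
            rw [e1] at hbits
            rw [hbits.2.1] at hdis
            rw [e0, e1]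
            refine Or.inr ⟨Or.inl rfl, fun hface => hdis ⟨?_, hface⟩⟩
            simp only [hπdef, eraseMid, mem_setOf_eq, e0, ne_eq, hne, not_false_eq_true, and_true]
          · exfalso
            have hc3 : ¬ (w 0 = i ∨ w 0 = i + 1) := not_or.2 ⟨hc2, hc1⟩
            rw [hg1, hg2, if_neg hc1, if_neg hc3, if_neg hc1, if_neg hc3] at hdis
            refine hdis ⟨?_, ?_⟩
            · simp only [hπdef, eraseMid, mem_setOf_eq, ne_eq, hc1, not_false_eq_true, and_true]
            · simp only [hπdef, eraseMid, mem_setOf_eq, ne_eq, hc2, not_false_eq_true, hc1, and_self,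
                and_true]
      · left
        rw [hU]
        simp only [mem_iUnion, Finset.mem_Icc, mem_setOf_eq, exists_prop]
        refine ⟨w 1, ?_, hmemC⟩
        have := hw.2
        constructor <;> linarith [(abs_le.1 this).1, (abs_le.1 this).2]
    -- measure bound
    have hC0 : C ≤ max C 0 := le_max_left _ _
    have hmax : 0 ≤ max C 0 := le_max_right _ _
    have hterm : ENNReal.ofReal (C * Real.exp (-c * r)) ≤ ENNReal.ofReal (max C 0 * Real.exp (-c * r)) :=
      ENNReal.ofReal_le_ofReal (mul_le_mul_of_nonneg_right hC0 (Real.exp_pos _).le)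
    have hUbd : P U ≤ ((2 * r + 1 : ℕ) : ℝ≥0∞) * ENNReal.ofReal (max C 0 * Real.exp (-c * r)) := by
      have hcard : (Finset.Icc (v 1 - r) (v 1 + r)).card = 2 * r + 1 := by
        rw [Int.card_Icc]; omega
      calc P U ≤ ∑ y ∈ Finset.Icc (v 1 - r) (v 1 + r), P {xu | (π xu.1, xu.2) ∉ Coal y r} :=
            measure_biUnion_finset_le _ _
        _ ≤ ∑ y ∈ Finset.Icc (v 1 - r) (v 1 + r), ENNReal.ofReal (max C 0 * Real.exp (-c * r)) :=
            Finset.sum_le_sum fun y _ => (hCt y r).trans hterm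
        _ = ((2 * r + 1 : ℕ) : ℝ≥0∞) * ENNReal.ofReal (max C 0 * Real.exp (-c * r)) := by
            rw [Finset.sum_const, hcard, nsmul_eq_mul]
    have hDbd : P D ≤ ENNReal.ofReal (max C 0 * Real.exp (-c * r)) := hGb.trans hterm
    calc P _ ≤ P (U ∪ D) := measure_mono hincl
      _ ≤ P U + P D := measure_union_le _ _
      _ ≤ ((2 * r + 1 : ℕ) : ℝ≥0∞) * ENNReal.ofReal (max C 0 * Real.exp (-c * r)) +
            ENNReal.ofReal (max C 0 * Real.exp (-c * r)) := add_le_add hUbd hDbd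
      _ = ENNReal.ofReal ((2 * r + 2 : ℕ) * (max C 0 * Real.exp (-c * r))) := by
            rw [ENNReal.ofReal_mul (p := ((2 * r + 2 : ℕ) : ℝ)) (by positivity), ENNReal.ofReal_natCast]
            push_cast
            ring
      _ ≤ ENNReal.ofReal (max C 0 * (2 + 4 / c) * Real.exp (-(c / 2) * r)) := by
            refine ENNReal.ofReal_le_ofReal ?_
            have := ps2_const_bound hc hmax r
            push_cast
            exact this

end Assembly

/-- THE CODING STEP, PROVED (registered sub-goal `ps2_pinnedSampler_of_rowCFTP`): for every pair of
constants `C, c > 0` there are constants `C' = max C 0 · (2 + 4/c)`, `c' = c/2` such that, for every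
column pattern `S` and face column `i`, a ROW-RESAMPLING DYNAMICS `Φ` of the middle data (measurable;
writing only the middle row it visits; vertically covariant; EXACT: every sweep of the rows `a … a+n-1` from
`X' ∼ νmix (S ∆ {i,i+1})` with fresh bits has, jointly with the pinned statistic and on the events not
reading the rows `≥ a+n`, the law of `X'`) with
CERTIFIED COALESCENCE events `Coal y m` (measurable; sound: the sweep of rows `y-m … y` forgets its start at
row `y`; failing with `νmix S ⊗ β`-probability `≤ C e^{-cm}`; vertically covariant) and `2r`-local
approximants of the depth-`r` sweeps off probability `≤ C e^{-cr}`, together with `StripDiagramExchange S i`,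
yield a pinned sampler with constants `C', c'` — the coupling-from-the-past map, upgraded to sure clauses
by `ps_pinnedSampler_of_ae`. [folklore] -/
theorem ps2_pinnedSampler_of_rowCFTP :
    ∀ (C c : ℝ), 0 < c → ∃ C' c' : ℝ, 0 < c' ∧ ∀ (S : Set ℤ) (i : ℤ)
      (Φ : ℤ → Obs × Set (Site 2 × Site 2) → Rnd → Obs → Obs)
      (Coal : ℤ → ℕ → Set ((Obs × Set (Site 2 × Site 2)) × Rnd)),
      (∀ y, Measurable fun t : (Obs × Set (Site 2 × Site 2)) × (Rnd × Obs) => Φ y t.1 t.2.1 t.2.2) →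
      (∀ y p u z, (∀ w : Site 2, w ≠ ![i + 1, y] → (w ∈ (Φ y p u z).1 ↔ w ∈ z.1)) ∧
        (∀ f : Site 2, f ≠ ![i, y] → f ≠ ![i + 1, y] → (f ∈ (Φ y p u z).2 ↔ f ∈ z.2))) →
      (∀ (y k : ℤ) (x : Obs) (u : Rnd) (z : Obs),
        Φ y (eraseMid i (vshift k x), stripDiagram i (vshift k x)) (ushift k u) (vshift k z) =
          vshift k (Φ (y - k) (eraseMid i x, stripDiagram i x) u z)) →
      (∀ (n : ℕ) (a : ℤ) (D : Set ((Obs × Set (Site 2 × Site 2)) × Obs)), MeasurableSet D →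
        (∀ (p : Obs × Set (Site 2 × Site 2)) (z z' : Obs), (∀ w : Site 2, w 1 < a + n →
          (w ∈ z.1 ↔ w ∈ z'.1) ∧ (w ∈ z.2 ↔ w ∈ z'.2)) → ((p, z) ∈ D ↔ (p, z') ∈ D)) →
        ((νmix (symmDiff S {i, i + 1})).prod β) {xu | ((eraseMid i xu.1, stripDiagram i xu.1),
          ((fun q : ℤ × Obs => (q.1 + 1, Φ q.1 (eraseMid i xu.1, stripDiagram i xu.1) xu.2 q.2))^[n]
            (a, xu.1)).2) ∈ D} =
        (νmix (symmDiff S {i, i + 1})) {x | ((eraseMid i x, stripDiagram i x), x) ∈ D}) →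
      (∀ y m, MeasurableSet (Coal y m)) →
      (∀ (y : ℤ) (m : ℕ) (p : Obs × Set (Site 2 × Site 2)) (u : Rnd), (p, u) ∈ Coal y m → ∀ z : Obs,
        (![i + 1, y] ∈ (((fun q : ℤ × Obs => (q.1 + 1, Φ q.1 p u q.2))^[m + 1] (y - m, z)).2).1 ↔
          ![i + 1, y] ∈ (((fun q : ℤ × Obs => (q.1 + 1, Φ q.1 p u q.2))^[m + 1] (y - m, p.1)).2).1) ∧
        (![i, y] ∈ (((fun q : ℤ × Obs => (q.1 + 1, Φ q.1 p u q.2))^[m + 1] (y - m, z)).2).2 ↔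
          ![i, y] ∈ (((fun q : ℤ × Obs => (q.1 + 1, Φ q.1 p u q.2))^[m + 1] (y - m, p.1)).2).2) ∧
        (![i + 1, y] ∈ (((fun q : ℤ × Obs => (q.1 + 1, Φ q.1 p u q.2))^[m + 1] (y - m, z)).2).2 ↔
          ![i + 1, y] ∈ (((fun q : ℤ × Obs => (q.1 + 1, Φ q.1 p u q.2))^[m + 1] (y - m, p.1)).2).2)) →
      (∀ (y : ℤ) (m : ℕ), ((νmix S).prod β)
          {xu | ((eraseMid i xu.1, stripDiagram i xu.1), xu.2) ∉ Coal y m} ≤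
        ENNReal.ofReal (C * Real.exp (-c * m))) →
      (∀ (y : ℤ) (m : ℕ) (k : ℤ) (x : Obs) (u : Rnd),
        ((eraseMid i (vshift k x), stripDiagram i (vshift k x)), ushift k u) ∈ Coal y m ↔
          ((eraseMid i x, stripDiagram i x), u) ∈ Coal (y - k) m) →
      (∀ (v : Site 2) (r : ℕ), ∃ Gfin : Obs → Rnd → Obs,
        (∀ (x x' : Obs) (u u' : Rnd),
          (∀ w ∈ ballInf v (2 * r), (w ∈ x.1 ↔ w ∈ x'.1) ∧ (w ∈ x.2 ↔ w ∈ x'.2) ∧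
            ∀ k : ℕ, ((w, k) ∈ u ↔ (w, k) ∈ u')) →
          ∀ w ∈ ballInf v r, (w ∈ (Gfin x u).1 ↔ w ∈ (Gfin x' u').1) ∧
            (w ∈ (Gfin x u).2 ↔ w ∈ (Gfin x' u').2)) ∧
        ((νmix S).prod β) {xu | ∃ w ∈ ballInf v r,
          (w 0 = i + 1 ∧ ¬ (w ∈ (((fun q : ℤ × Obs =>
              (q.1 + 1, Φ q.1 (eraseMid i xu.1, stripDiagram i xu.1) xu.2 q.2))^[r + 1]
              (w 1 - r, eraseMid i xu.1)).2).1 ↔ w ∈ (Gfin xu.1 xu.2).1)) ∨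
          ((w 0 = i ∨ w 0 = i + 1) ∧ ¬ (w ∈ (((fun q : ℤ × Obs =>
              (q.1 + 1, Φ q.1 (eraseMid i xu.1, stripDiagram i xu.1) xu.2 q.2))^[r + 1]
              (w 1 - r, eraseMid i xu.1)).2).2 ↔ w ∈ (Gfin xu.1 xu.2).2))} ≤
          ENNReal.ofReal (C * Real.exp (-c * r))) →
      StripDiagramExchange S i →
      ∃ G : Obs → Rnd → Obs, PinnedSampler C' c' S i G := by
  intro C c hc
  refine ⟨max C 0 * (2 + 4 / c), c / 2, by linarith, ?_⟩
  intro S i Φ Coal hΦm hW hΦcov hLaw hCm hCs hCt hCcov hLoc hX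
  haveI : StandardBorelSpace (Set (Site 2)) := inferInstanceAs (StandardBorelSpace (Site 2 → Prop))
  haveI : StandardBorelSpace (Set (Site 2 × Site 2)) :=
    inferInstanceAs (StandardBorelSpace (Site 2 × Site 2 → Prop))
  haveI : IsProbabilityMeasure β := by
    rw [show β = sitePercolation (Site 2 × ℕ) half from rfl]; infer_instance
  haveI := isProbabilityMeasure_nuMix S
  haveI := isProbabilityMeasure_nuMix (S ∆ {i, i + 1})
  -- the sweeps, named
  obtain ⟨T, hT⟩ : ∃ T : ℕ → ℤ → Obs × Set (Site 2 × Site 2) → Rnd → Obs → Obs, ∀ n a p u z,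
      T n a p u z = ((fun q : ℤ × Obs => (q.1 + 1, Φ q.1 p u q.2))^[n] (a, z)).2 :=
    ⟨fun n a p u z => ((fun q : ℤ × Obs => (q.1 + 1, Φ q.1 p u q.2))^[n] (a, z)).2, fun _ _ _ _ _ => rfl⟩
  set π : Obs → Obs × Set (Site 2 × Site 2) := fun x => (eraseMid i x, stripDiagram i x) with hπdef
  have hπ : Measurable π := ps2_measurable_stat i
  have hπid : Measurable fun xu : Obs × Rnd => (π xu.1, xu.2) :=
    (hπ.comp measurable_fst).prodMk measurable_snd
  have hLaw' : ∀ (n : ℕ) (a : ℤ) (D : Set ((Obs × Set (Site 2 × Site 2)) × Obs)), MeasurableSet D →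
      (∀ (p : Obs × Set (Site 2 × Site 2)) (z z' : Obs), (∀ w : Site 2, w 1 < a + n →
        (w ∈ z.1 ↔ w ∈ z'.1) ∧ (w ∈ z.2 ↔ w ∈ z'.2)) → ((p, z) ∈ D ↔ (p, z') ∈ D)) →
      ((νmix (S ∆ {i, i + 1})).prod β) {xu | ((eraseMid i xu.1, stripDiagram i xu.1),
        T n a (eraseMid i xu.1, stripDiagram i xu.1) xu.2 xu.1) ∈ D} =
      (νmix (S ∆ {i, i + 1})) {x | ((eraseMid i x, stripDiagram i x), x) ∈ D} := fun n a D hDm hD => by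
    simp only [hT]; exact hLaw n a D hDm hD
  have hCs' : ∀ (y : ℤ) (m : ℕ) (p : Obs × Set (Site 2 × Site 2)) (u : Rnd), (p, u) ∈ Coal y m →
      ∀ z : Obs, (![i + 1, y] ∈ (T (m + 1) (y - m) p u z).1 ↔ ![i + 1, y] ∈ (T (m + 1) (y - m) p u p.1).1) ∧
        (![i, y] ∈ (T (m + 1) (y - m) p u z).2 ↔ ![i, y] ∈ (T (m + 1) (y - m) p u p.1).2) ∧
        (![i + 1, y] ∈ (T (m + 1) (y - m) p u z).2 ↔ ![i + 1, y] ∈ (T (m + 1) (y - m) p u p.1).2) :=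
    fun y m p u h z => by simp only [hT]; exact hCs y m p u h z
  have hLoc' : ∀ (v : Site 2) (r : ℕ), ∃ Gfin : Obs → Rnd → Obs,
      (∀ (x x' : Obs) (u u' : Rnd),
        (∀ w ∈ ballInf v (2 * r), (w ∈ x.1 ↔ w ∈ x'.1) ∧ (w ∈ x.2 ↔ w ∈ x'.2) ∧
          ∀ k : ℕ, ((w, k) ∈ u ↔ (w, k) ∈ u')) →
        ∀ w ∈ ballInf v r, (w ∈ (Gfin x u).1 ↔ w ∈ (Gfin x' u').1) ∧
          (w ∈ (Gfin x u).2 ↔ w ∈ (Gfin x' u').2)) ∧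
      ((νmix S).prod β) {xu | ∃ w ∈ ballInf v r,
        (w 0 = i + 1 ∧ ¬ (w ∈ (T (r + 1) (w 1 - r) (eraseMid i xu.1, stripDiagram i xu.1) xu.2
          (eraseMid i xu.1, stripDiagram i xu.1).1).1 ↔ w ∈ (Gfin xu.1 xu.2).1)) ∨
        ((w 0 = i ∨ w 0 = i + 1) ∧ ¬ (w ∈ (T (r + 1) (w 1 - r) (eraseMid i xu.1, stripDiagram i xu.1) xu.2
          (eraseMid i xu.1, stripDiagram i xu.1).1).2 ↔ w ∈ (Gfin xu.1 xu.2).2))} ≤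
        ENNReal.ofReal (C * Real.exp (-c * r)) := fun v r => by
    simp only [hT]; exact hLoc v r
  -- the coupling-from-the-past map
  obtain ⟨g, hg1, hg2⟩ : ∃ g : (Obs × Set (Site 2 × Site 2)) × Rnd → Obs,
      (∀ p u (w : Site 2), w ∈ (g (p, u)).1 ↔ if w 0 = i + 1 then
        ∃ m : ℕ, ((p, u) ∈ Coal (w 1) m ∧ ∀ m' < m, (p, u) ∉ Coal (w 1) m') ∧
          w ∈ (T (m + 1) (w 1 - m) p u p.1).1 else w ∈ p.1.1) ∧
      (∀ p u (f : Site 2), f ∈ (g (p, u)).2 ↔ if (f 0 = i ∨ f 0 = i + 1) then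
        ∃ m : ℕ, ((p, u) ∈ Coal (f 1) m ∧ ∀ m' < m, (p, u) ∉ Coal (f 1) m') ∧
          f ∈ (T (m + 1) (f 1 - m) p u p.1).2 else f ∈ p.1.2) :=
    ⟨fun q => ({w | if w 0 = i + 1 then
        ∃ m : ℕ, (q ∈ Coal (w 1) m ∧ ∀ m' < m, q ∉ Coal (w 1) m') ∧
          w ∈ (T (m + 1) (w 1 - m) q.1 q.2 q.1.1).1 else w ∈ q.1.1.1},
      {f | if (f 0 = i ∨ f 0 = i + 1) then
        ∃ m : ℕ, (q ∈ Coal (f 1) m ∧ ∀ m' < m, q ∉ Coal (f 1) m') ∧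
          f ∈ (T (m + 1) (f 1 - m) q.1 q.2 q.1.1).2 else f ∈ q.1.1.2}),
      fun _ _ _ => Iff.rfl, fun _ _ _ => Iff.rfl⟩
  have hgm : Measurable g := ps2_measurable_cftp hT hΦm hCm hg1 hg2
  have hjoint := ps2_cftp_jointLaw S i Φ T Coal g hT hΦm hW hLaw' hCm hCs'
    (fun y => ps2_coal_ae_finite hc hX hCm hCt y) hg1 hg2
  set JG : Obs × Rnd → (Obs × Set (Site 2 × Site 2)) × Obs := fun xu => (π xu.1, g (π xu.1, xu.2))
    with hJGdef
  set J : Obs → (Obs × Set (Site 2 × Site 2)) × Obs := fun x => (π x, x) with hJdef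
  have hJG : Measurable JG :=
    (hπ.comp measurable_fst).prodMk (hgm.comp ((hπ.comp measurable_fst).prodMk measurable_snd))
  have hJ : Measurable J := hπ.prodMk measurable_id
  refine ps_pinnedSampler_of_ae _ _ S i (fun x u => g (π x, u)) (hgm.comp hπid) ?_
    (Eventually.of_forall fun xu m => ps2_cftp_cov hT hΦcov hCcov hg1 hg2 m xu.1 xu.2) (fun _ => ?_)
    (ps2_cftp_locality hc hT hCs' hCt hLoc' hg1 hg2)
  · -- the pinned statistic is preserved almost surely
    have hF : MeasurableSet {q : (Obs × Set (Site 2 × Site 2)) × Obs | stripDiagram i q.2 ≠ q.1.2} :=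
      (measurableSet_eq_fun ((ps_measurable_stripDiagram i).comp measurable_snd)
        (measurable_snd.comp measurable_fst)).compl
    have hE : MeasurableSet {q : (Obs × Set (Site 2 × Site 2)) × Rnd | stripDiagram i (g q) ≠ q.1.2} :=
      (measurableSet_eq_fun ((ps_measurable_stripDiagram i).comp hgm)
        (measurable_snd.comp measurable_fst)).compl
    have hzero : ((νmix S).prod β) {xu | stripDiagram i (g (π xu.1, xu.2)) ≠ stripDiagram i xu.1} = 0 := by
      have h1 : {xu : Obs × Rnd | stripDiagram i (g (π xu.1, xu.2)) ≠ stripDiagram i xu.1} =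
          (fun xu : Obs × Rnd => (π xu.1, xu.2)) ⁻¹'
            {q : (Obs × Set (Site 2 × Site 2)) × Rnd | stripDiagram i (g q) ≠ q.1.2} := rfl
      rw [h1, ← Measure.map_apply hπid hE, ps2_stat_prod_map S i hX, Measure.map_apply hπid hE]
      have h2 : (fun xu : Obs × Rnd => (π xu.1, xu.2)) ⁻¹'
          {q : (Obs × Set (Site 2 × Site 2)) × Rnd | stripDiagram i (g q) ≠ q.1.2} =
          JG ⁻¹' {q : (Obs × Set (Site 2 × Site 2)) × Obs | stripDiagram i q.2 ≠ q.1.2} := rfl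
      rw [h2, ← Measure.map_apply hJG hF, hjoint, Measure.map_apply hJ hF]
      have h3 : J ⁻¹' {q : (Obs × Set (Site 2 × Site 2)) × Obs | stripDiagram i q.2 ≠ q.1.2} = ∅ := by
        ext x; simp [hJdef, hπdef]
      rw [h3, measure_empty]
    rw [ae_iff]
    refine measure_mono_null (fun xu hxu => ?_) hzero
    simp only [mem_setOf_eq, not_and_or] at hxu ⊢
    rcases hxu with h | h
    · exact absurd (ps2_cftp_eraseMid hg1 hg2 xu.1 xu.2) h
    · exact h
  · -- the exchanged law is transported
    have h1 : (Function.uncurry fun x u => g (π x, u)) = Prod.snd ∘ JG := by funext xu; rfl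
    have h2 : ((νmix S).prod β).map (Prod.snd ∘ JG) = ((νmix (S ∆ {i, i + 1})).prod β).map (Prod.snd ∘ JG) := by
      have h3 : Prod.snd ∘ JG = g ∘ fun xu : Obs × Rnd => (π xu.1, xu.2) := by funext xu; rfl
      rw [h3, ← Measure.map_map hgm hπid, ← Measure.map_map hgm hπid, ps2_stat_prod_map S i hX]
    rw [h1, h2, ← Measure.map_map measurable_snd hJG, hjoint, Measure.map_map measurable_snd hJ]
    exact Measure.map_id

end Summit.CriticalPhenomena.CardyFormulaZ2.Theorems.IKLinearTransport.PinnedDiagramExchange
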